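import Literature.Combinatorics.Sahi2008.RichardsInduction
import Literature.Combinatorics.Sahi2008.ConjugateCumulants
import Literature.Combinatorics.Sahi2008.UniformSquareAllOrders
import HarnessLib

/-!
# Richards (2004), §2 at orders four and five: the displays (2.16), (2.17) ("the claim analogous to (2.5)")
# and their exact status

CITATION HEADER.  Source: D. St. P. Richards, *Algebraic methods toward higher-order probability inequalities, II*,
Ann. Probab. **32** (2004) 1509–1544 [Richards2004], pp. 1513 and 1519–1521 (proof of Theorem 1.3), read from the
materialised Project Euclid copy (`paper:url-a35428b45c2b`, p0005, p0011–p0013).  Companion of `RichardsInduction.lean`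
(order three, (2.5)–(2.13)).  Verbatim (p. 1519–1520): "PROOF OF THEOREM 1.3. To show that (1.8) is nonnegative, we
follow the same approach as in the case of Theorem 1.1. … In the case of four increasing functions `f_i`, `i = 1, 2, 3, 4`,
the claim analogous to (2.5) is that, for any `B ⊆ A`, `6E_B((f₁f₂f₃f₄)_B) − 2[E_B((f₁f₂f₃)_B f_{4B}) + ⋯] −
[E_B((f₁f₂)_B(f₃f₄)_B) + ⋯] + [E_B((f₁f₂)_B f_{3B}f_{4B}) + ⋯] + E_B(f_{1B}f_{2B}f_{3B}f_{4B}) ≥ 0.` (2.16) [so in the text layer of our copy; by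
(1.8)/(2.21) the last sign is `−`]  Proceeding as
in Remark 2.4, we apply MAPLE to verify that all coefficients in the monomial expansion of the corresponding polynomial
`Φ₁(u + v; v)` are nonnegative. Once this has been done, the remainder of the proof follows the arguments given in the
latter part of the proof of Theorem 1.1.  To prove that (1.9) is nonnegative, we begin with the claim that [(2.17), the
fifth-order analogue] for any `B ⊆ A`. Next we construct the corresponding polynomial `Φ₁(u; v)`, apply MAPLE to verify
the nonnegativity of all coefficients in the monomial expansion of `Φ₁(u + v; v)`, and then the remainder of the proof is
as before."  (The coefficient pattern of (2.16)/(2.17) is that of the conjugate cumulants `κ′₄`, `κ′₅` of (1.8)/(1.9),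
i.e. of (2.21); the printed displays deviate from it — in BOTH the journal text layer and the independent arXiv
typesetting arXiv:math/0410155v1 (checked 2026-08-20 from the PDF text operators): (2.16) ends `+ E_B(f_{1B}⋯f_{4B})`
where (1.8)/(2.21) give `−`, and (2.17) shows the coefficients `−2, −1, −1, +1, +1, −1` where (1.9)/(2.21) give
`−6, −2, +2, +1, −1, +1` — so the displays are misprinted in the source, and the transcription below uses the
DEFINITION (2.21) (`Richards2004.conjCumulant`, = Sahi's `E_n` for `n ≤ 5` [Sahi2008, p. 213]), the only reading under
which `forall_displayConj_nonneg_iff` holds.)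

What is here (everything PROVED; no named fact; `B = A ∖ C` as in `RichardsInduction.lean`):
* `Richards2004.displayConj μ C n f` — the order-`n` display: `κ′_n` ((2.21)) with every correlation product
  `Π_β E(Π_{i∈β} f_i)` replaced by `E_B(Π_β (Π_{i∈β} f_i)_B)`; `n = 3` is (2.5) (`displayConj_three`), `n = 4, 5` are
  (2.16), (2.17).
* **`displayConj_eq_sum_conjCumulant`** — for every order and every `B`: the display is `Σ_a µ_B(a)·κ′_n^{ν_a}(f(a ∪ ·))`,
  hence for `n ≤ 5` an average of instances of Sahi's `E_n` under the conditional laws (`displayConj_eq_sum_sahiE`);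
  `displayConj_univ` — at `B = ∅` it is `κ′_n` itself ((1.8)/(1.9) for `n = 4, 5`).
* **`displayConj_nonneg_singleton`** — THE PRINTED STEP `B = A ∖ {z}` for every order `1 ≤ n ≤ 5` WITHOUT MAPLE: the
  conditional laws are two-point chains `{a, a ∪ {z}}`, on which `E_n ≥ 0` for every `n` is Blinovsky's chain lemma
  (`sahiPositive_of_linearOrder`, transported by the moment congruence `sahiE_congr_of_moments`): `sahiE_condLaw_singleton_nonneg`.
* **`forall_displayConj_nonneg_iff`** — for `1 ≤ n ≤ 5`: "the display is nonnegative for every `B`, every FKG weight and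
  all nonnegative increasing `f`" ⟺ `C_n` on `2^A`; so, exactly as at order three, "the remainder of the proof … as
  before" (setting `B = ∅`) is the open conjecture `C_4` resp. `C_5` [LiebSahi2021, p. 3].  Nothing is asserted about `C_n`.
-- TODO(general form): orders `n ≥ 6` (where `κ′_n ≠ E_n`, [Sahi2008, p. 214]) are not treated; Richards' MAPLE
-- certificates themselves (the polynomials `Φ₁(u+v; v)`) are not transcribed — the chain lemma replaces them.

## References
* D. St. P. Richards, Ann. Probab. 32 (2004) 1509–1544, Thm. 1.3 (p. 1513), (2.16)–(2.17) (pp. 1519–1520), (2.21)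
  (p. 1521). [Richards2004]
* S. Sahi, *Higher correlation inequalities*, Combinatorica 28 (2008), p. 213 (`κ′_n = E_n`, `n ≤ 5`). [Sahi2008]
* V. Blinovsky, *Correlation inequality for formal series*, CRM Series 16 (2013), Lemma 1. [Blinovsky2013FormalSeries]
* E. H. Lieb, S. Sahi, J. Math. Phys. 63 (2022) 043301, p. 3. [LiebSahi2021]
-/

noncomputable section

namespace Literature.Combinatorics.Sahi2008

namespace Richards2004

open Finset Literature.Probability.LatticeModels.POAlgebra PartitionForm

variable {ι : Type*} [Fintype ι] [DecidableEq ι] {n : ℕ}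

/-- **Richards' display of order `n` at `B = A ∖ C`** ("the claim analogous to (2.5)"; (2.16) for `n = 4`, (2.17) for
`n = 5`): the conjugate cumulant `κ′_n = Σ_π (−1)^{l(π)−1}(λ₁(π)−1)!·E_π` with each correlation product
`E_π = Π_{β∈π} E(Π_{i∈β} f_i)` replaced by `E_B(Π_{β∈π} (Π_{i∈β} f_i)_B)`.
[cite: Richards2004, (2.16)–(2.17) (pp. 1519–1520), (2.21) (p. 1521)] -/
def displayConj (μ : Finset ι → ℝ) (C : Finset ι) (n : ℕ) (f : Fin n → Finset ι → ℝ) : ℝ :=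
  ∑ c : OrderedFinpartition n, ((-1 : ℝ) ^ (c.length - 1) * ((maxPart c - 1).factorial : ℝ)) *
    ex (marg μ C) (fun a => ∏ m : Fin c.length, cexp μ (∏ x ∈ block c m, f x) C a)

/-- Blockwise: `µ_B(a)·Π_β (Π_{i∈β} f_i)_B(a) = µ_B(a)·Π_β E_{ν_a}(Π_{i∈β} f_i(a ∪ ·))` — the integrand of the display at
`a` is the correlation product under the conditional law `ν_a`. [cite: Richards2004, (2.3) (p. 1514–1515)] -/
theorem marg_mul_prod_cexp_eq (μ : Finset ι → ℝ) (f : Fin n → Finset ι → ℝ) (C a : Finset ι)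
    (c : OrderedFinpartition n) :
    marg μ C a * ∏ m : Fin c.length, cexp μ (∏ x ∈ block c m, f x) C a =
      marg μ C a * corrProd (condLaw μ C a) (fun i b => f i (a ∪ b)) c := by
  by_cases h : marg μ C a = 0
  · rw [h, zero_mul, zero_mul]
  · unfold corrProd
    congr 1
    refine prod_congr rfl fun m _ => ?_
    rw [cexp_eq_ex_condLaw _ h]
    congr 1
    funext b
    simp only [Finset.prod_apply]

/-- **THE EXACT STATUS at every order.**  For every `B = A ∖ C`, every weight and every family:
`display_n(B) = Σ_a µ_B(a)·κ′_n^{ν_a}(f₁(a ∪ ·),…,f_n(a ∪ ·))` — Richards' display of order `n` is an average over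
`a ⊆ B` of conjugate cumulants under the conditional laws on `2^{A∖B}`. [cite: Richards2004, (2.16)–(2.17) (pp. 1519–1520)] -/
theorem displayConj_eq_sum_conjCumulant (μ : Finset ι → ℝ) (C : Finset ι) (n : ℕ) (f : Fin n → Finset ι → ℝ) :
    displayConj μ C n f = ∑ a, marg μ C a * conjCumulant (condLaw μ C a) n (fun i b => f i (a ∪ b)) := by
  unfold displayConj conjCumulant ex
  simp_rw [mul_sum]
  rw [sum_comm]
  refine sum_congr rfl fun a _ => sum_congr rfl fun c _ => ?_
  rw [marg_mul_prod_cexp_eq]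
  ring

/-- For `1 ≤ n ≤ 5` (so for (2.5), (2.16), (2.17)) the display is an average of instances of Sahi's `E_n` under the
conditional laws, because `κ′_n = E_n` there. [cite: Richards2004, (2.16)–(2.17) (pp. 1519–1520); Sahi2008, p. 213] -/
theorem displayConj_eq_sum_sahiE (h1 : 1 ≤ n) (h5 : n ≤ 5) (μ : Finset ι → ℝ) (C : Finset ι)
    (f : Fin n → Finset ι → ℝ) :
    displayConj μ C n f = ∑ a, marg μ C a * sahiE (condLaw μ C a) n (fun i b => f i (a ∪ b)) := by
  rw [displayConj_eq_sum_conjCumulant]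
  simp_rw [conjCumulant_eq_sahiE h1 h5]

/-- Order three of the general display is (2.5). [cite: Richards2004, (2.5) (p. 1515)] -/
theorem displayConj_three (μ : Finset ι → ℝ) (f₁ f₂ f₃ : Finset ι → ℝ) (C : Finset ι) :
    displayConj μ C 3 ![f₁, f₂, f₃] = display25 μ f₁ f₂ f₃ C := by
  rw [displayConj_eq_sum_sahiE (by norm_num) (by norm_num), display25_eq_sum_sahiE]
  refine sum_congr rfl fun a _ => ?_
  congr 2
  funext i
  fin_cases i <;> rfl

/-- **At `B = ∅` the display is `κ′_n` itself** ((1.8) for `n = 4`, (1.9) for `n = 5`), for a probability weight —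
"the remainder of the proof follows the arguments given in the latter part of the proof of Theorem 1.1" means setting
`B = ∅` here. [cite: Richards2004, pp. 1517 and 1520] -/
theorem displayConj_univ {μ : Finset ι → ℝ} (hμ1 : ∑ b, μ b = 1) (n : ℕ) (f : Fin n → Finset ι → ℝ) :
    displayConj μ univ n f = conjCumulant μ n f := by
  rw [displayConj_eq_sum_conjCumulant,
    Fintype.sum_eq_single ∅ (fun a ha => by rw [marg_univ, if_neg ha, zero_mul]), marg_univ, if_pos rfl, hμ1,
    one_mul, condLaw_univ_empty hμ1]
  simp only [empty_union]

/-! ### The printed step `B = A ∖ {z}` at every order, by the chain lemma instead of MAPLE -/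

/-- **`E_n ≥ 0` under the two-point conditional laws, every order.**  For `µ ≥ 0`, `µ_{A∖{z}}(a) ≠ 0` and nonnegative
increasing `g_i`, `E_n^{ν_a}(g₁(a ∪ ·),…,g_n(a ∪ ·)) ≥ 0`: the law `ν_a` is carried by the chain `{a, a ∪ {z}}`, so the
moments are those of a probability weight on the two-point chain `{false < true}`, where Blinovsky's Lemma 1
(`sahiPositive_of_linearOrder`) applies; the transfer is the moment congruence `sahiE_congr_of_moments`.  (Richards
verifies the orders `4, 5` instead by MAPLE, p. 1520.) [cite: Richards2004, p. 1520; Blinovsky2013FormalSeries, Lemma 1] -/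
theorem sahiE_condLaw_singleton_nonneg {μ : Finset ι → ℝ} (hμ0 : ∀ α, 0 ≤ μ α) {z : ι} {a : Finset ι}
    (h : marg μ {z} a ≠ 0) (n : ℕ) (g : Fin n → Finset ι → ℝ) (hg0 : ∀ i x, 0 ≤ g i x)
    (hgm : ∀ i, Monotone (g i)) : 0 ≤ sahiE (condLaw μ {z} a) n (fun i b => g i (a ∪ b)) := by
  have hz : z ∉ a := by
    intro hz; rw [marg_singleton, if_pos hz] at h; exact h rfl
  have h26 : marg μ {z} a = μ a + μ (a ∪ {z}) := by rw [marg_singleton, if_neg hz]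
  have hB : μ a + μ (a ∪ {z}) ≠ 0 := h26 ▸ h
  -- the two-point chain law and the transported family
  let ρ : Bool → ℝ := fun t => if t then μ (a ∪ {z}) / (μ a + μ (a ∪ {z})) else μ a / (μ a + μ (a ∪ {z}))
  let hh : Fin n → Bool → ℝ := fun i t => if t then g i (a ∪ {z}) else g i a
  have key : sahiE (condLaw μ {z} a) n (fun i b => g i (a ∪ b)) = sahiE ρ n hh := by
    refine sahiE_congr_of_moments _ _ n _ _ fun S _ => ?_
    have e1 : (∏ i ∈ S, fun b => g i (a ∪ b)) = fun b => ∏ i ∈ S, g i (a ∪ b) := by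
      funext b; simp only [Finset.prod_apply]
    have E := marg_mul_ex_condLaw_singleton h fun x => ∏ i ∈ S, g i x
    rw [h26] at E
    have E' : ex (condLaw μ {z} a) (fun b => ∏ i ∈ S, g i (a ∪ b)) =
        (μ a * ∏ i ∈ S, g i a + μ (a ∪ {z}) * ∏ i ∈ S, g i (a ∪ {z})) / (μ a + μ (a ∪ {z})) := by
      rw [eq_div_iff hB, mul_comm]
      exact E
    rw [e1, E']
    simp only [ex, Fintype.sum_bool, Finset.prod_apply, ρ, hh, if_true, if_false, Bool.false_eq_true]
    field_simp
    ring
  rw [key]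
  refine sahiPositive_of_linearOrder (α := Bool) (μ := ρ) (fun t => ?_) ?_ n hh (fun i t => ?_) (fun i => ?_)
  · cases t
    · exact div_nonneg (hμ0 _) (add_nonneg (hμ0 _) (hμ0 _))
    · exact div_nonneg (hμ0 _) (add_nonneg (hμ0 _) (hμ0 _))
  · simp only [Fintype.sum_bool, ρ, if_true, if_false, Bool.false_eq_true]
    field_simp
    ring
  · cases t
    · exact hg0 i a
    · exact hg0 i (a ∪ {z})
  · intro t t' htt'
    cases t <;> cases t'
    · exact le_rfl
    · exact hgm i subset_union_left
    · exact absurd htt' (by decide)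
    · exact le_rfl

/-- **Richards' step `B = A ∖ {z}` for the displays of orders `1 ≤ n ≤ 5`** (so (2.5), (2.16), (2.17)), for every
nonnegative weight and all nonnegative increasing `f_i`, WITHOUT computer algebra: each conditional law is a two-point
chain, and `E_n ≥ 0` on chains is Blinovsky's Lemma 1. [cite: Richards2004, (2.16)–(2.17) and p. 1520;
Blinovsky2013FormalSeries, Lemma 1] -/
theorem displayConj_nonneg_singleton (h1 : 1 ≤ n) (h5 : n ≤ 5) {μ : Finset ι → ℝ} (hμ0 : ∀ α, 0 ≤ μ α)
    (f : Fin n → Finset ι → ℝ) (hf0 : ∀ i x, 0 ≤ f i x) (hfm : ∀ i, Monotone (f i)) (z : ι) :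
    0 ≤ displayConj μ {z} n f := by
  rw [displayConj_eq_sum_sahiE h1 h5]
  refine sum_nonneg fun a _ => ?_
  by_cases h : marg μ {z} a = 0
  · rw [h, zero_mul]
  · exact mul_nonneg (marg_nonneg hμ0 _ _) (sahiE_condLaw_singleton_nonneg hμ0 h n f hf0 hfm)

/-! ### The display for every `B` ⟺ `C_n` (`n ≤ 5`) -/

/-- **The display at `B` follows from `E_n ≥ 0` under the conditional laws** (`1 ≤ n ≤ 5`, `μ ≥ 0`, `f_i ≥ 0`
increasing). [cite: Richards2004, (2.16)–(2.17) (pp. 1519–1520); LiebSahi2021, p. 3] -/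
theorem displayConj_nonneg_of_sahiPositive (h1 : 1 ≤ n) (h5 : n ≤ 5) {μ : Finset ι → ℝ} (hμ0 : ∀ α, 0 ≤ μ α)
    {C : Finset ι} (hpos : ∀ a, marg μ C a ≠ 0 → SahiPositive (condLaw μ C a) n) (f : Fin n → Finset ι → ℝ)
    (hf0 : ∀ i x, 0 ≤ f i x) (hfm : ∀ i, Monotone (f i)) : 0 ≤ displayConj μ C n f := by
  rw [displayConj_eq_sum_sahiE h1 h5]
  refine sum_nonneg fun a _ => ?_
  by_cases h : marg μ C a = 0
  · rw [h, zero_mul]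
  · exact mul_nonneg (marg_nonneg hμ0 _ _)
      (hpos a h _ (fun i x => hf0 i _) fun i => monotone_comp_union (hfm i) a)

/-- **Given `C_n` on `2^A`, the display holds at every `B`** (`1 ≤ n ≤ 5`; the conditional laws of an FKG weight are
FKG, `isFKGMeasure_condLaw`). [cite: Richards2004, (2.16)–(2.17) (pp. 1519–1520); LiebSahi2021, p. 3] -/
theorem displayConj_nonneg_of_forall_sahiPositive (h1 : 1 ≤ n) (h5 : n ≤ 5)
    (hC : ∀ ν : Finset ι → ℝ, IsFKGMeasure ν → SahiPositive ν n) {μ : Finset ι → ℝ} (hμ : IsFKGMeasure μ)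
    (f : Fin n → Finset ι → ℝ) (hf0 : ∀ i x, 0 ≤ f i x) (hfm : ∀ i, Monotone (f i)) (C : Finset ι) :
    0 ≤ displayConj μ C n f :=
  displayConj_nonneg_of_sahiPositive h1 h5 hμ.nonneg (fun _ ha => hC _ (isFKGMeasure_condLaw hμ ha)) f hf0 hfm

/-- **"The display for every `B`" ⟺ `C_n` on `2^A`, for each order `1 ≤ n ≤ 5`.**  In particular for `n = 4, 5`:
Richards' claims (2.16)/(2.17) "for any `B ⊆ A`" are, weight class by weight class, the conjectures `C_4`, `C_5`
(`⇒`: `B = ∅` gives (1.8)/(1.9) = `E_4, E_5 ≥ 0`; `⇐`: conditional laws are FKG); what is proved in print — and here without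
MAPLE, `displayConj_nonneg_singleton` — is the case `B = A ∖ {z}`.  Nothing is asserted about `C_n`.
[cite: Richards2004, Thm. 1.3 (p. 1513) and pp. 1519–1520; LiebSahi2021, p. 3; Sahi2008, Conj. 5 (p. 212)] -/
theorem forall_displayConj_nonneg_iff (h1 : 1 ≤ n) (h5 : n ≤ 5) :
    (∀ (μ : Finset ι → ℝ), IsFKGMeasure μ → ∀ (f : Fin n → Finset ι → ℝ), (∀ i x, 0 ≤ f i x) →
        (∀ i, Monotone (f i)) → ∀ C, 0 ≤ displayConj μ C n f) ↔
      ∀ ν : Finset ι → ℝ, IsFKGMeasure ν → SahiPositive ν n := by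
  constructor
  · intro h ν hν f hf hfm
    have hn := h ν hν f hf hfm univ
    rwa [displayConj_univ hν.sum_eq_one, conjCumulant_eq_sahiE h1 h5] at hn
  · intro hC μ hμ f hf0 hfm C
    exact displayConj_nonneg_of_forall_sahiPositive h1 h5 hC hμ f hf0 hfm C

end Richards2004

end Literature.Combinatorics.Sahi2008
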